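import Mathlib

/-!
# Sketch — crux-ideate stmt-FinalStateConjecture-13550 (`StarvedNecks.HonestFixedRadiusSettling`),
# round 1, ideator 1: first lemmas of the idea `far-field-surgery`

The crux asks, Christodoulou-generically, for `C⁴` (`k = 4`) convergence of the pulled-back metric
on every truncated near-zone slab and on every FULL flat slab, while the admissible class
`admissibleVacuumData X` controls only `h = (1 + 2M/r)δ + o₂(r⁻¹)`, `k = o₁(r⁻²)` — two derivatives
of `h`, one of `k`, at spatial infinity.  The linear shadow below records that this derivative
budget is EXACTLY `k = 2`: incoming spherical waves whose Cauchy data obey the admissible decay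
converge to `0` at every fixed radius together with two time derivatives, but a sparse incoming
train with the same decay has UNBOUNDED third time derivative at every fixed radius (focusing of
`F(t + r)/r`).  Dictionary: `ψ(t, x) := (F(t + |x|) − F(t − |x|)) / |x|` solves `□ψ = 0` on `ℝ¹⁺³`;
its data on `{t = 0}` are `(F(|x|)/|x|, F'(|x|)/|x|)` (as `F = 0` on `(−∞, 1]`), which satisfy
`|∂ʲψ₀| = o(|x|^{-1-j})` (`j ≤ 2`), `|∂ʲψ₁| = o(|x|^{-2-j})` (`j ≤ 1`) as soon as
`sʲ F⁽ʲ⁾(s) → 0` for `j ≤ 2`; and `∂ₜʲ ψ(t, r₀ω) = (F⁽ʲ⁾(t + r₀) − F⁽ʲ⁾(t − r₀)) / r₀`.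
-/

namespace Summit.FinalStateConjecture.FinalStateConjecture.Cruxes.HonestFixedRadiusSettling.FarFieldSurgery

open Filter Topology Set MeasureTheory
open scoped ContDiff

/-- **First lemma, positive half (the admissible budget is exactly two derivatives).**
For every smooth incoming profile `F` vanishing on `(−∞, 1]` with the admissible-type decay
`sʲ F⁽ʲ⁾(s) → 0` (`j ≤ 2`), the spherical wave `ψ = (F(t+r) − F(t−r))/r` and its first two time
derivatives tend to `0` at every fixed radius `r₀ > 0`:
`(F⁽ʲ⁾(t + r₀) − F⁽ʲ⁾(t − r₀))/r₀ → 0` as `t → ∞`, `j ≤ 2`. (Provable now: `F⁽ʲ⁾ → 0`.) -/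
def AdmissibleProfileSettlesC2 : Prop :=
  ∀ F : ℝ → ℝ, ContDiff ℝ ∞ F → (∀ s ≤ 1, F s = 0) →
    (∀ j ≤ 2, Tendsto (fun s : ℝ ↦ s ^ j * iteratedDeriv j F s) atTop (𝓝 0)) →
    ∀ r₀ : ℝ, 0 < r₀ → ∀ j ≤ 2,
      Tendsto (fun t : ℝ ↦ (iteratedDeriv j F (t + r₀) - iteratedDeriv j F (t - r₀)) / r₀)
        atTop (𝓝 0)

/-- **First lemma, negative half (`k = 3` already exceeds the budget).**  There is a smooth
incoming profile `F`, vanishing on `(−∞, 1]`, with the admissible-type decay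
`sʲ F⁽ʲ⁾(s) → 0` for `j ≤ 2` and finite energy `∫₁^∞ F'(s)² ds < ∞`, such that at EVERY fixed
radius `r₀ > 0` the third time derivative of the spherical wave,
`(F'''(t + r₀) − F'''(t − r₀))/r₀`, is unbounded on `t ≥ 0`.
(Witness: a sparse train `F = Σₙ Aₙ φ(ωₙ(s − Lₙ))`, `Lₙ = 2^{2ⁿ}`, `ωₙ = Lₙ³`, `Aₙ = n⁻¹ Lₙ⁻⁸`:
`Aₙωₙ²Lₙ² = 1/n → 0`, `Aₙωₙ³ = Lₙ/n → ∞`, gaps eventually exceed `2r₀`.) -/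
def AdmissibleTrainDefeatsC3 : Prop :=
  ∃ F : ℝ → ℝ, ContDiff ℝ ∞ F ∧ (∀ s ≤ 1, F s = 0) ∧
    (∀ j ≤ 2, Tendsto (fun s : ℝ ↦ s ^ j * iteratedDeriv j F s) atTop (𝓝 0)) ∧
    IntegrableOn (fun s : ℝ ↦ deriv F s ^ 2) (Ioi 1) ∧
    ∀ r₀ : ℝ, 0 < r₀ →
      ¬ BddAbove (range fun t : Ici (0 : ℝ) ↦
        |(iteratedDeriv 3 F ((t : ℝ) + r₀) - iteratedDeriv 3 F ((t : ℝ) - r₀)) / r₀|)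

/-- **The spherical-wave dictionary is honest** (provable now, classical): for `F` of class `C²`
the function `u(t, r) := F (t + r) − F (t − r)` satisfies the `1 + 1` wave equation
`∂ₜ²u = ∂ᵣ²u`, which is the radial reduction `∂ₜ²(rψ) = ∂ᵣ²(rψ)` of `□ψ = 0` for
`ψ = u / r` on `r > 0`. Stated with iterated one-variable derivatives. -/
def SphericalWaveDictionary : Prop :=
  ∀ F : ℝ → ℝ, ContDiff ℝ 2 F → ∀ t r : ℝ,
    iteratedDeriv 2 (fun τ : ℝ ↦ F (τ + r) - F (τ - r)) t =
      iteratedDeriv 2 (fun ρ : ℝ ↦ F (t + ρ) - F (t - ρ)) r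

/-- The positive half holds (proof: `sʲF⁽ʲ⁾ → 0` and `s ≥ 1` give `F⁽ʲ⁾ → 0`; compose with
the translations `t ↦ t ± r₀`). -/
theorem admissibleProfileSettlesC2_holds : AdmissibleProfileSettlesC2 := by
  intro F _hF _h0 hdec r₀ _hr₀ j hj
  have key : Tendsto (fun s : ℝ ↦ iteratedDeriv j F s) atTop (𝓝 0) := by
    have h := hdec j hj
    rw [tendsto_zero_iff_norm_tendsto_zero] at h ⊢
    refine squeeze_zero' (Eventually.of_forall fun s ↦ norm_nonneg _) ?_ h
    filter_upwards [eventually_ge_atTop (1 : ℝ)] with s hs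
    rw [norm_mul]
    have hpow : (1 : ℝ) ≤ ‖s ^ j‖ := by
      rw [Real.norm_eq_abs, abs_of_nonneg (by positivity)]
      exact one_le_pow₀ hs
    calc ‖iteratedDeriv j F s‖ = 1 * ‖iteratedDeriv j F s‖ := by ring
      _ ≤ ‖s ^ j‖ * ‖iteratedDeriv j F s‖ := by gcongr
  have h1 : Tendsto (fun t : ℝ ↦ iteratedDeriv j F (t + r₀)) atTop (𝓝 0) :=
    key.comp (tendsto_atTop_add_const_right _ _ tendsto_id)
  have h2 : Tendsto (fun t : ℝ ↦ iteratedDeriv j F (t + -r₀)) atTop (𝓝 0) :=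
    key.comp (tendsto_atTop_add_const_right _ _ tendsto_id)
  have h3 := (h1.sub h2).div_const r₀
  simp only [sub_zero, zero_div] at h3
  simpa [sub_eq_add_neg] using h3

/-- Sanity (proved): the three statements are propositions about real functions only; the
negative half is consistent with the positive half because it concerns the THIRD derivative. -/
example : AdmissibleProfileSettlesC2 → AdmissibleTrainDefeatsC3 →
    (AdmissibleProfileSettlesC2 ∧ AdmissibleTrainDefeatsC3) := fun h₁ h₂ ↦ ⟨h₁, h₂⟩

end Summit.FinalStateConjecture.FinalStateConjecture.Cruxes.HonestFixedRadiusSettling.FarFieldSurgery
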